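/-
COR-CM (cell pub-hodgecm2, stage 2 of the Hodge ladder) — count-neutral KERNEL COMBINATORICS «the octic product column G = Q₈ × B, D₄ × B: the closing lattice over the central y»
(seat prover-pub-hodgecm2-b23-g45-0, binder prover b23, gen 45; own census lane OCTIC-PRODUCT, claim HOME/INBOX.md l.18829).  Theorems only — §3 of gen 44ʼs `Census/QuarticInversionLattice.lean` (its tables `Gk0/GCv0/mu0/Gk1/GCv1/mu1`, `ΨL` and the finite checks `B_eq_sum_G0/1` BY NAME: the normal forms of the translates of the equator squares are LITERALLY the same for the central `y`, `Census/OcticProductOrbit.nf_zS/nf_tzS`) over the value module of `Census/OcticProductOrbit.lean`; `decide` only on closed identities between literal integer/Boolean tables, no certificate, no named fact, no `sorry`.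
`Interfaces.lean` (C1), every E term, B01, `Transposition/*`, `PortJoin/*`, `D2Bridge/*` untouched.
HONEST FRAMING: `HC_CM` is NOT proved, here or anywhere in the tree; nothing here is a period, a count of record or a headline.
T5: n/a-class (hypothesis binders = the datum equations / the slot data only); checker: self, 2026-08-24.
-/
import Summits.HodgeConjecture.CorCM.Census.QuarticInversionLattice
import Summits.HodgeConjecture.CorCM.Census.OcticProductTrees

/-!
# The octic product column: the closing lattice over the central `y` — the finite check (gen 44ʼs tables) and the conclusion

COR-CM (cell `pub-hodgecm2`, stage 2 of the Hodge ladder), count-neutral KERNEL COMBINATORICS by the binder seat b23 (gen 45; lane OCTIC-PRODUCT, HOME/INBOX.md l.18829 — the port of gen 44ʼs quartic inversion lane `Census/QuarticInversion*` to the datum with `y` CENTRAL on `ι(H₀)`).  On top of the corresponding parts of gen 44ʼs lane `Census/QuarticInversion*` (label-level, BY NAME) and the preceding `Census/OcticProduct*` files.  Bookkeeping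
definitions with bodies (`ΨL`, the integer tables `Gk0/1`, `GCv0/1`, `mu0/1`) + theorems; `decide` only on closed identities between literal integer
tables over `Fin 4`, `Fin 8`, `Fin 12`, `Fin 16` and on closed values at literal patterns (the finite index-one check of the closing lattice; the
tables were produced by this folder's `work/gen/l8.py` and are re-checked here by the kernel), no certificate, no named fact, no geometry, no
`sorry`.  `Interfaces.lean` (C1), every E term, B01, `Transposition/*`, `PortJoin/*`, `D2Bridge/*` untouched.
HONEST FRAMING: `HC_CM` is NOT proved, here or anywhere in the tree; nothing here is a period, a count of record or a headline.

CONTENT (`|B|` odd `≥ 3`, square class `ζ`, a slot datum `(P,u₁,u₂;Q,w,u₀)` and a cross datum `(σ,s₀)` as in gen 44ʼs part XVII).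
* §3 **The finite check**: for `ζ = 0` and `ζ = 1`, every basis vector `B_l` of the relation lattice (gen 44ʼs part XIX) is an explicit integer
  combination of the tables of the twelve normal forms of `g·S_b` (`g ∈ {e, y, t, ty}`, `b ∈ {TTT, TTF, TFT}`; `B_eq_sum_G0/1`), and these
  tables ARE the normal forms of gen 44ʼs part XVIII (`ΦL_G0_mem`, `ΦL_G1_mem`: so they lie in the value module of `B1`).
* §4 **CONCLUSION**: for every Hodge vector `x`, `nf x` and hence `Avec x` lie in the value module of `B1` (`nf_mem_valMod_of_hodge`,
  `Avec_mem_valMod_of_hodge`): every value of every functional on `x` is realised inside the orbit span of the ten closing faces.  All [folklore].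

## References
* [Pohlmann1968] H. Pohlmann, Algebraic cycles on abelian varieties of complex multiplication type, Ann. of Math. 88 (1968), Thm 1.
-/

namespace Summit.HodgeConjecture.CorCM.Census.OcticProduct

open Finset
open Summit.HodgeConjecture.CorCM.Census.OddSliceFacesModel

open Summit.HodgeConjecture.CorCM.Census.QuarticInversion (Avec Avec_mem_of_nf_mem B_eq_sum_G0 B_eq_sum_G1 GCv0 GCv1 Gk0 Gk1 Ty₄ cB famB1 famB1_subset_hodge₄ fnl fnl_wC_not funext_pat hodge₄ kC_decomp kOf kS kT kTY kY mem_S_TFT mem_S_TTF mem_S_TTT mu0 mu1 nf nf_S nf_eq_ΦL nf_tS pT pY rel01_lit rel02_lit rel03_lit rel4_lit tab16 wC ΨL ΨL_apply)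

noncomputable section

section Members
variable (A : Type) [AddCommGroup A] [Fintype A] [DecidableEq A]
variable {P : Finset A} {u₁ u₂ : A} {Q : Finset A} {w u₀ σ s₀ : A}

/-- **Every generator normal form lies in the value module of `B1`, `ζ = 0`.** [folklore] -/
theorem ΦL_G0_mem (hA : Odd (Fintype.card A)) (h3 : 3 ≤ Fintype.card A) (h1 : u₁ ∉ P) (h2 : u₂ ∉ P) (h12 : u₁ ≠ u₂)
    (hP : P.card + 1 = Fintype.card A / 2) (hs₀ : s₀ ∈ insert u₁ (insert u₂ P))
    (hX : ∀ s, s + σ ∈ insert u₁ (insert u₂ P) ↔ (s ∉ insert u₁ (insert u₂ P) ∨ s = s₀)) (hw : w ∉ Q)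
    (hQ : Q.card = Fintype.card A / 2) (i : Fin 12) :
    ΨL A (Gk0 i, GCv0 i) ∈ valMod A 0 ↑(famB1 A P u₁ u₂ Q w u₀) := by
  have hF := famB1_subset_hodge₄ A (P := P) (Q := Q) (w := w) (u₀ := u₀) h12
  have hbin := all_bin A hA h3 0 h1 h2 h12 hP hs₀ hX hw hQ (u₀ := u₀)
  have mTTT := subset_orbSpan A 0 _ (mem_S_TTT A P u₁ u₂ Q w u₀)
  have mTTF := subset_orbSpan A 0 _ (mem_S_TTF A P u₁ u₂ Q w u₀)
  have mTFT := subset_orbSpan A 0 _ (mem_S_TFT A P u₁ u₂ Q w u₀)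
  fin_cases i
  · show ΨL A (Gk0 0, GCv0 0) ∈ _
    have e : ((Gk0 0, tab16 (GCv0 0)) : (Fin 4 → ℤ) × ((Fin 4 → Bool) → ℤ)) = (kS, cB ![false, true, true, true]) :=
      Prod.ext (by decide) (funext_pat fun a b c d => by cases a <;> cases b <;> cases c <;> cases d <;> decide)
    have h := nf_mem_of_bin A hA hF hbin mTTT
    rw [nf_S A hA h1 h2 h12 hP ![false, true, true, true]] at h
    rw [ΨL_apply, e]; exact h
  · show ΨL A (Gk0 1, GCv0 1) ∈ _
    have e : ((Gk0 1, tab16 (GCv0 1)) : (Fin 4 → ℤ) × ((Fin 4 → Bool) → ℤ)) = (kY 0, fun η => cB ![false, true, true, true] (pY 0 η)) :=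
      Prod.ext (by decide) (funext_pat fun a b c d => by cases a <;> cases b <;> cases c <;> cases d <;> decide)
    have h := nf_mem_of_bin A hA hF hbin (translZ_mem_orbSpan A 0 _ mTTT)
    rw [nf_zS A hA h1 h2 h12 hP ![false, true, true, true]] at h
    rw [ΨL_apply, e]; exact h
  · show ΨL A (Gk0 2, GCv0 2) ∈ _
    have e : ((Gk0 2, tab16 (GCv0 2)) : (Fin 4 → ℤ) × ((Fin 4 → Bool) → ℤ)) = (kT, fun η => cB ![false, true, true, true] (pT η)) :=
      Prod.ext (by decide) (funext_pat fun a b c d => by cases a <;> cases b <;> cases c <;> cases d <;> decide)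
    have h := nf_mem_of_bin A hA hF hbin (translT_mem_orbSpan A 0 _ mTTT)
    rw [nf_tS A hA h1 h2 h12 hP ![false, true, true, true]] at h
    rw [ΨL_apply, e]; exact h
  · show ΨL A (Gk0 3, GCv0 3) ∈ _
    have e : ((Gk0 3, tab16 (GCv0 3)) : (Fin 4 → ℤ) × ((Fin 4 → Bool) → ℤ)) = (kTY 0, fun η => cB ![false, true, true, true] (pY 0 (pT η))) :=
      Prod.ext (by decide) (funext_pat fun a b c d => by cases a <;> cases b <;> cases c <;> cases d <;> decide)
    have h := nf_mem_of_bin A hA hF hbin (translT_mem_orbSpan A 0 _ (translZ_mem_orbSpan A 0 _ mTTT))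
    rw [nf_tzS A hA h1 h2 h12 hP ![false, true, true, true]] at h
    rw [ΨL_apply, e]; exact h
  · show ΨL A (Gk0 4, GCv0 4) ∈ _
    have e : ((Gk0 4, tab16 (GCv0 4)) : (Fin 4 → ℤ) × ((Fin 4 → Bool) → ℤ)) = (kS, cB ![false, true, true, false]) :=
      Prod.ext (by decide) (funext_pat fun a b c d => by cases a <;> cases b <;> cases c <;> cases d <;> decide)
    have h := nf_mem_of_bin A hA hF hbin mTTF
    rw [nf_S A hA h1 h2 h12 hP ![false, true, true, false]] at h
    rw [ΨL_apply, e]; exact h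
  · show ΨL A (Gk0 5, GCv0 5) ∈ _
    have e : ((Gk0 5, tab16 (GCv0 5)) : (Fin 4 → ℤ) × ((Fin 4 → Bool) → ℤ)) = (kY 0, fun η => cB ![false, true, true, false] (pY 0 η)) :=
      Prod.ext (by decide) (funext_pat fun a b c d => by cases a <;> cases b <;> cases c <;> cases d <;> decide)
    have h := nf_mem_of_bin A hA hF hbin (translZ_mem_orbSpan A 0 _ mTTF)
    rw [nf_zS A hA h1 h2 h12 hP ![false, true, true, false]] at h
    rw [ΨL_apply, e]; exact h
  · show ΨL A (Gk0 6, GCv0 6) ∈ _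
    have e : ((Gk0 6, tab16 (GCv0 6)) : (Fin 4 → ℤ) × ((Fin 4 → Bool) → ℤ)) = (kT, fun η => cB ![false, true, true, false] (pT η)) :=
      Prod.ext (by decide) (funext_pat fun a b c d => by cases a <;> cases b <;> cases c <;> cases d <;> decide)
    have h := nf_mem_of_bin A hA hF hbin (translT_mem_orbSpan A 0 _ mTTF)
    rw [nf_tS A hA h1 h2 h12 hP ![false, true, true, false]] at h
    rw [ΨL_apply, e]; exact h
  · show ΨL A (Gk0 7, GCv0 7) ∈ _
    have e : ((Gk0 7, tab16 (GCv0 7)) : (Fin 4 → ℤ) × ((Fin 4 → Bool) → ℤ)) = (kTY 0, fun η => cB ![false, true, true, false] (pY 0 (pT η))) :=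
      Prod.ext (by decide) (funext_pat fun a b c d => by cases a <;> cases b <;> cases c <;> cases d <;> decide)
    have h := nf_mem_of_bin A hA hF hbin (translT_mem_orbSpan A 0 _ (translZ_mem_orbSpan A 0 _ mTTF))
    rw [nf_tzS A hA h1 h2 h12 hP ![false, true, true, false]] at h
    rw [ΨL_apply, e]; exact h
  · show ΨL A (Gk0 8, GCv0 8) ∈ _
    have e : ((Gk0 8, tab16 (GCv0 8)) : (Fin 4 → ℤ) × ((Fin 4 → Bool) → ℤ)) = (kS, cB ![false, true, false, true]) :=
      Prod.ext (by decide) (funext_pat fun a b c d => by cases a <;> cases b <;> cases c <;> cases d <;> decide)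
    have h := nf_mem_of_bin A hA hF hbin mTFT
    rw [nf_S A hA h1 h2 h12 hP ![false, true, false, true]] at h
    rw [ΨL_apply, e]; exact h
  · show ΨL A (Gk0 9, GCv0 9) ∈ _
    have e : ((Gk0 9, tab16 (GCv0 9)) : (Fin 4 → ℤ) × ((Fin 4 → Bool) → ℤ)) = (kY 0, fun η => cB ![false, true, false, true] (pY 0 η)) :=
      Prod.ext (by decide) (funext_pat fun a b c d => by cases a <;> cases b <;> cases c <;> cases d <;> decide)
    have h := nf_mem_of_bin A hA hF hbin (translZ_mem_orbSpan A 0 _ mTFT)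
    rw [nf_zS A hA h1 h2 h12 hP ![false, true, false, true]] at h
    rw [ΨL_apply, e]; exact h
  · show ΨL A (Gk0 10, GCv0 10) ∈ _
    have e : ((Gk0 10, tab16 (GCv0 10)) : (Fin 4 → ℤ) × ((Fin 4 → Bool) → ℤ)) = (kT, fun η => cB ![false, true, false, true] (pT η)) :=
      Prod.ext (by decide) (funext_pat fun a b c d => by cases a <;> cases b <;> cases c <;> cases d <;> decide)
    have h := nf_mem_of_bin A hA hF hbin (translT_mem_orbSpan A 0 _ mTFT)
    rw [nf_tS A hA h1 h2 h12 hP ![false, true, false, true]] at h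
    rw [ΨL_apply, e]; exact h
  · show ΨL A (Gk0 11, GCv0 11) ∈ _
    have e : ((Gk0 11, tab16 (GCv0 11)) : (Fin 4 → ℤ) × ((Fin 4 → Bool) → ℤ)) = (kTY 0, fun η => cB ![false, true, false, true] (pY 0 (pT η))) :=
      Prod.ext (by decide) (funext_pat fun a b c d => by cases a <;> cases b <;> cases c <;> cases d <;> decide)
    have h := nf_mem_of_bin A hA hF hbin (translT_mem_orbSpan A 0 _ (translZ_mem_orbSpan A 0 _ mTFT))
    rw [nf_tzS A hA h1 h2 h12 hP ![false, true, false, true]] at h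
    rw [ΨL_apply, e]; exact h

/-- **Every generator normal form lies in the value module of `B1`, `ζ = 1`.** [folklore] -/
theorem ΦL_G1_mem (hA : Odd (Fintype.card A)) (h3 : 3 ≤ Fintype.card A) (h1 : u₁ ∉ P) (h2 : u₂ ∉ P) (h12 : u₁ ≠ u₂)
    (hP : P.card + 1 = Fintype.card A / 2) (hs₀ : s₀ ∈ insert u₁ (insert u₂ P))
    (hX : ∀ s, s + σ ∈ insert u₁ (insert u₂ P) ↔ (s ∉ insert u₁ (insert u₂ P) ∨ s = s₀)) (hw : w ∉ Q)
    (hQ : Q.card = Fintype.card A / 2) (i : Fin 12) :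
    ΨL A (Gk1 i, GCv1 i) ∈ valMod A 1 ↑(famB1 A P u₁ u₂ Q w u₀) := by
  have hF := famB1_subset_hodge₄ A (P := P) (Q := Q) (w := w) (u₀ := u₀) h12
  have hbin := all_bin A hA h3 1 h1 h2 h12 hP hs₀ hX hw hQ (u₀ := u₀)
  have mTTT := subset_orbSpan A 1 _ (mem_S_TTT A P u₁ u₂ Q w u₀)
  have mTTF := subset_orbSpan A 1 _ (mem_S_TTF A P u₁ u₂ Q w u₀)
  have mTFT := subset_orbSpan A 1 _ (mem_S_TFT A P u₁ u₂ Q w u₀)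
  fin_cases i
  · show ΨL A (Gk1 0, GCv1 0) ∈ _
    have e : ((Gk1 0, tab16 (GCv1 0)) : (Fin 4 → ℤ) × ((Fin 4 → Bool) → ℤ)) = (kS, cB ![false, true, true, true]) :=
      Prod.ext (by decide) (funext_pat fun a b c d => by cases a <;> cases b <;> cases c <;> cases d <;> decide)
    have h := nf_mem_of_bin A hA hF hbin mTTT
    rw [nf_S A hA h1 h2 h12 hP ![false, true, true, true]] at h
    rw [ΨL_apply, e]; exact h
  · show ΨL A (Gk1 1, GCv1 1) ∈ _
    have e : ((Gk1 1, tab16 (GCv1 1)) : (Fin 4 → ℤ) × ((Fin 4 → Bool) → ℤ)) = (kY 1, fun η => cB ![false, true, true, true] (pY 1 η)) :=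
      Prod.ext (by decide) (funext_pat fun a b c d => by cases a <;> cases b <;> cases c <;> cases d <;> decide)
    have h := nf_mem_of_bin A hA hF hbin (translZ_mem_orbSpan A 1 _ mTTT)
    rw [nf_zS A hA h1 h2 h12 hP ![false, true, true, true]] at h
    rw [ΨL_apply, e]; exact h
  · show ΨL A (Gk1 2, GCv1 2) ∈ _
    have e : ((Gk1 2, tab16 (GCv1 2)) : (Fin 4 → ℤ) × ((Fin 4 → Bool) → ℤ)) = (kT, fun η => cB ![false, true, true, true] (pT η)) :=
      Prod.ext (by decide) (funext_pat fun a b c d => by cases a <;> cases b <;> cases c <;> cases d <;> decide)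
    have h := nf_mem_of_bin A hA hF hbin (translT_mem_orbSpan A 1 _ mTTT)
    rw [nf_tS A hA h1 h2 h12 hP ![false, true, true, true]] at h
    rw [ΨL_apply, e]; exact h
  · show ΨL A (Gk1 3, GCv1 3) ∈ _
    have e : ((Gk1 3, tab16 (GCv1 3)) : (Fin 4 → ℤ) × ((Fin 4 → Bool) → ℤ)) = (kTY 1, fun η => cB ![false, true, true, true] (pY 1 (pT η))) :=
      Prod.ext (by decide) (funext_pat fun a b c d => by cases a <;> cases b <;> cases c <;> cases d <;> decide)
    have h := nf_mem_of_bin A hA hF hbin (translT_mem_orbSpan A 1 _ (translZ_mem_orbSpan A 1 _ mTTT))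
    rw [nf_tzS A hA h1 h2 h12 hP ![false, true, true, true]] at h
    rw [ΨL_apply, e]; exact h
  · show ΨL A (Gk1 4, GCv1 4) ∈ _
    have e : ((Gk1 4, tab16 (GCv1 4)) : (Fin 4 → ℤ) × ((Fin 4 → Bool) → ℤ)) = (kS, cB ![false, true, true, false]) :=
      Prod.ext (by decide) (funext_pat fun a b c d => by cases a <;> cases b <;> cases c <;> cases d <;> decide)
    have h := nf_mem_of_bin A hA hF hbin mTTF
    rw [nf_S A hA h1 h2 h12 hP ![false, true, true, false]] at h
    rw [ΨL_apply, e]; exact h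
  · show ΨL A (Gk1 5, GCv1 5) ∈ _
    have e : ((Gk1 5, tab16 (GCv1 5)) : (Fin 4 → ℤ) × ((Fin 4 → Bool) → ℤ)) = (kY 1, fun η => cB ![false, true, true, false] (pY 1 η)) :=
      Prod.ext (by decide) (funext_pat fun a b c d => by cases a <;> cases b <;> cases c <;> cases d <;> decide)
    have h := nf_mem_of_bin A hA hF hbin (translZ_mem_orbSpan A 1 _ mTTF)
    rw [nf_zS A hA h1 h2 h12 hP ![false, true, true, false]] at h
    rw [ΨL_apply, e]; exact h
  · show ΨL A (Gk1 6, GCv1 6) ∈ _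
    have e : ((Gk1 6, tab16 (GCv1 6)) : (Fin 4 → ℤ) × ((Fin 4 → Bool) → ℤ)) = (kT, fun η => cB ![false, true, true, false] (pT η)) :=
      Prod.ext (by decide) (funext_pat fun a b c d => by cases a <;> cases b <;> cases c <;> cases d <;> decide)
    have h := nf_mem_of_bin A hA hF hbin (translT_mem_orbSpan A 1 _ mTTF)
    rw [nf_tS A hA h1 h2 h12 hP ![false, true, true, false]] at h
    rw [ΨL_apply, e]; exact h
  · show ΨL A (Gk1 7, GCv1 7) ∈ _
    have e : ((Gk1 7, tab16 (GCv1 7)) : (Fin 4 → ℤ) × ((Fin 4 → Bool) → ℤ)) = (kTY 1, fun η => cB ![false, true, true, false] (pY 1 (pT η))) :=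
      Prod.ext (by decide) (funext_pat fun a b c d => by cases a <;> cases b <;> cases c <;> cases d <;> decide)
    have h := nf_mem_of_bin A hA hF hbin (translT_mem_orbSpan A 1 _ (translZ_mem_orbSpan A 1 _ mTTF))
    rw [nf_tzS A hA h1 h2 h12 hP ![false, true, true, false]] at h
    rw [ΨL_apply, e]; exact h
  · show ΨL A (Gk1 8, GCv1 8) ∈ _
    have e : ((Gk1 8, tab16 (GCv1 8)) : (Fin 4 → ℤ) × ((Fin 4 → Bool) → ℤ)) = (kS, cB ![false, true, false, true]) :=
      Prod.ext (by decide) (funext_pat fun a b c d => by cases a <;> cases b <;> cases c <;> cases d <;> decide)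
    have h := nf_mem_of_bin A hA hF hbin mTFT
    rw [nf_S A hA h1 h2 h12 hP ![false, true, false, true]] at h
    rw [ΨL_apply, e]; exact h
  · show ΨL A (Gk1 9, GCv1 9) ∈ _
    have e : ((Gk1 9, tab16 (GCv1 9)) : (Fin 4 → ℤ) × ((Fin 4 → Bool) → ℤ)) = (kY 1, fun η => cB ![false, true, false, true] (pY 1 η)) :=
      Prod.ext (by decide) (funext_pat fun a b c d => by cases a <;> cases b <;> cases c <;> cases d <;> decide)
    have h := nf_mem_of_bin A hA hF hbin (translZ_mem_orbSpan A 1 _ mTFT)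
    rw [nf_zS A hA h1 h2 h12 hP ![false, true, false, true]] at h
    rw [ΨL_apply, e]; exact h
  · show ΨL A (Gk1 10, GCv1 10) ∈ _
    have e : ((Gk1 10, tab16 (GCv1 10)) : (Fin 4 → ℤ) × ((Fin 4 → Bool) → ℤ)) = (kT, fun η => cB ![false, true, false, true] (pT η)) :=
      Prod.ext (by decide) (funext_pat fun a b c d => by cases a <;> cases b <;> cases c <;> cases d <;> decide)
    have h := nf_mem_of_bin A hA hF hbin (translT_mem_orbSpan A 1 _ mTFT)
    rw [nf_tS A hA h1 h2 h12 hP ![false, true, false, true]] at h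
    rw [ΨL_apply, e]; exact h
  · show ΨL A (Gk1 11, GCv1 11) ∈ _
    have e : ((Gk1 11, tab16 (GCv1 11)) : (Fin 4 → ℤ) × ((Fin 4 → Bool) → ℤ)) = (kTY 1, fun η => cB ![false, true, false, true] (pY 1 (pT η))) :=
      Prod.ext (by decide) (funext_pat fun a b c d => by cases a <;> cases b <;> cases c <;> cases d <;> decide)
    have h := nf_mem_of_bin A hA hF hbin (translT_mem_orbSpan A 1 _ (translZ_mem_orbSpan A 1 _ mTFT))
    rw [nf_tzS A hA h1 h2 h12 hP ![false, true, false, true]] at h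
    rw [ΨL_apply, e]; exact h

/-- **THE CLOSING LATTICE: the normal form of every Hodge vector lies in the value module `Avec (orbSpan B1)` of `B1`** (stated with the value module
unfolded). [folklore] -/
theorem nf_mem_valMod_of_hodge (hA : Odd (Fintype.card A)) (h3 : 3 ≤ Fintype.card A) (ζ : ZMod 2) (h1 : u₁ ∉ P) (h2 : u₂ ∉ P)
    (h12 : u₁ ≠ u₂) (hP : P.card + 1 = Fintype.card A / 2) (hs₀ : s₀ ∈ insert u₁ (insert u₂ P))
    (hX : ∀ s, s + σ ∈ insert u₁ (insert u₂ P) ↔ (s ∉ insert u₁ (insert u₂ P) ∨ s = s₀)) (hw : w ∉ Q)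
    (hQ : Q.card = Fintype.card A / 2) {x : Ty₄ A → ℤ} (hx : x ∈ hodge₄ A) :
    nf A x ∈ (orbSpan A ζ ↑(famB1 A P u₁ u₂ Q w u₀)).map (Avec A) := by
  show nf A x ∈ valMod A ζ ↑(famB1 A P u₁ u₂ Q w u₀)
  have hdec := kC_decomp (fun j => kOf A j x) (fun η => fnl A (wC A η) x) (fun η => fnl_wC_not A hA η x)
    (rel01_lit A hA hx) (rel02_lit A hA hx) (rel03_lit A hA hx) (rel4_lit A hA hx)
  rw [nf_eq_ΦL, hdec, map_sum]
  refine Submodule.sum_mem _ fun l _ => ?_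
  rw [map_smul]
  refine Submodule.smul_mem _ _ ?_
  have h01 : ∀ z : ZMod 2, z = 0 ∨ z = 1 := by decide
  rcases h01 ζ with rfl | rfl
  · rw [← ΨL_apply, B_eq_sum_G0 l, map_sum]
    refine Submodule.sum_mem _ fun i _ => ?_
    rw [map_smul]
    exact Submodule.smul_mem _ _ (ΦL_G0_mem A hA h3 h1 h2 h12 hP hs₀ hX hw hQ i)
  · rw [← ΨL_apply, B_eq_sum_G1 l, map_sum]
    refine Submodule.sum_mem _ fun i _ => ?_
    rw [map_smul]
    exact Submodule.smul_mem _ _ (ΦL_G1_mem A hA h3 h1 h2 h12 hP hs₀ hX hw hQ i)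

/-- **The value vector of every Hodge vector lies in the value module of `B1`**: `Avec x ∈ Avec (orbSpan B1)`. [folklore] -/
theorem Avec_mem_valMod_of_hodge (hA : Odd (Fintype.card A)) (h3 : 3 ≤ Fintype.card A) (ζ : ZMod 2) (h1 : u₁ ∉ P) (h2 : u₂ ∉ P)
    (h12 : u₁ ≠ u₂) (hP : P.card + 1 = Fintype.card A / 2) (hs₀ : s₀ ∈ insert u₁ (insert u₂ P))
    (hX : ∀ s, s + σ ∈ insert u₁ (insert u₂ P) ↔ (s ∉ insert u₁ (insert u₂ P) ∨ s = s₀)) (hw : w ∉ Q)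
    (hQ : Q.card = Fintype.card A / 2) {x : Ty₄ A → ℤ} (hx : x ∈ hodge₄ A) :
    Avec A x ∈ (orbSpan A ζ ↑(famB1 A P u₁ u₂ Q w u₀)).map (Avec A) :=
  Avec_mem_of_nf_mem A hA (all_bin A hA h3 ζ h1 h2 h12 hP hs₀ hX hw hQ) hx
    (nf_mem_valMod_of_hodge A hA h3 ζ h1 h2 h12 hP hs₀ hX hw hQ hx)

end Members

end

end Summit.HodgeConjecture.CorCM.Census.OcticProduct
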